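import Summits.CriticalPhenomena.PercolationContinuityZ3.Theorems.PercNearOneGluingNoHeavyConstsClusterSquareApexLinked
import Summits.CriticalPhenomena.PercolationContinuityZ3.Theorems.PercNearOneGluingNoHeavyConstsClusterSquareQuadClash
import HarnessLib

/-!
# Outerplanar graph plus one apex, the apex as a terminal: no QUADRUPLE clash at a rim root (endgame; no sector condition)

builds on p205010 (kernel theorem, internal audit signed; external expert review pending)

PAPER-2 track "percolation constants", part (ii), seat `prim-consts-1`, gen 21 (lane index
`run/shared/lean/prim/consts/CONSTANTS.md`, row A19; memo `FROM-prim-consts-1-g21-APEX-TERMINAL.md`).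
Support file for the crux `NoHeavyLowerTail` (stmt-CriticalPhenomena-4575; `--supports`).  Theorems only; no definitions, no sorries.

THE POINT.  Gen 18 (`…ConstsClusterSquareQuadClash.lean`) proved CSQ/DUU/TS at `(a; b, c)` as soon as no QUADRUPLE clash occurs: four
vertices `y ∈ C_b(C₁) ∩ C_c(C₃)`, `y' ∈ C_c(C₁) ∩ C_b(C₃)` (the cross double clash), `z ∈ C_b(C₁) ∩ C_b(C₃)`, `z' ∈ C_c(C₁) ∩ C_c(C₃)`
(same-side clashes), each joined to the cluster `K = C_a(C₁)` by a positive pair.  On an outerplanar rim graph plus one apex `h`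
inside a face ((R), (F) of `…ConstsClusterSquareApex.lean`), with `a, b` on the rim and `c = h` THE APEX, double clashes do occur
(rim 4-cycle, apex joined to two opposite corners, `a, b` the other corners; `…ApexHub.lean` excludes them under the sector
condition) — but a cross double clash NEVER comes with a same-side `b`-clash `z`, for ANY rim `a, b`:
* `Consts.not_quadClash_of_unlinked₃` (general vertex type): the no-quadruple-clash hypothesis of
  `Consts.clusterSquare_le_sq_of_noQuadClash_pos` follows from a purely combinatorial statement about `H ⊇` positive pairs — for
  every `H`-connected `K ∋ a` avoiding `b, c`, clash vertices `y ≠ y'`, `z ∉ {c, y, y'}` (`z = b` allowed) joined to `K`: either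
  every triple of walks `y → b, y' → c, z → b` in `H − K` has `y → b` or `z → b` meeting `y' → c`, or every triple
  `y → c, y' → b, z → b` has `y' → b` or `z → b` meeting `y → c` (the fourth vertex `z'` is not needed);
* `Consts.Apex.false_of_clash₃` (the endgame, cut open at the rim root `a`): the cross linkage puts `b` strictly between `y, y'`
  (sets `K ∪ {y}`, `K ∪ {y'}`) and then strictly between the apex-neighbours `x₁, x₂` that end the walks `y → h`, `y' → h` (sets
  `K ∪ supp(y→b)`, `K ∪ supp(y'→b)`); the `z`-walks, tested against `K ∪ supp(y'→h) ∋ x₂` and `K ∪ supp(y→h) ∋ x₁`, put `z`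
  strictly between `x₁` and `x₂` as well (also when `z = b`); all of them lie in one gap of `K`, so the `K`-neighbour `k₃` of `z`
  is outside `(x₁, x₂)` and the rim edge `{k₃, z}` interleaves the chord `{x₁, x₂}` — a forbidden crossing ((R)+(F)).
`…ConstsClusterSquareApexHubQuad.lean` assembles: CSQ/DUU at every rim root with the apex as a terminal and TS for EVERY triple
`{a, b, h}`, no sector condition; with gen 20's rim triples, TS for every triple of terminals of such a graph.
Census (lane engines g21 `eng/apex_clash3.py`, `eng/apex_quad.py`, exhaustive over ALL (R)+(F) graphs with ≤ 6 rim vertices =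
73 472 graphs, 11 096 928 rooted clusters): 41 298 cross double linkages, NONE with a same-side `b`-clash (0 triple clashes, hence 0
quadruple linkages); at the APEX root quadruple linkages do occur (`W₄`), cf. `…ApexHub.lean`.
References: N. Gladkov, arXiv:2408.08457v2 (2024), Def. 4.2, Thm. 4.3, Lemma 3.1, Ex. 2.5, Thm. 5.2; J. van den Berg, O. Häggström,
J. Kahn, Random Structures Algorithms 29 (2006), §1; G. Chartrand, F. Harary, Ann. Inst. H. Poincaré B 3 (1967) 433–438.
-/

noncomputable section

open Classical

namespace Summit.CriticalPhenomena.PercolationContinuityZ3.Theorems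

open MeasureTheory Finset Literature.Probability.LatticeModels Literature.Probability.Percolation
open Literature.Probability.Percolation.DecisionTree Literature.Probability.Percolation.BHK2006
open Literature.Probability.Percolation.TargetExploration Literature.Probability.Percolation.ClusterConditioning

namespace Consts

/-! ### Quadruple clashes, combinatorially: a cross double linkage plus one same-side clash -/

section General

variable {V : Type*}

/-- **No quadruple clash unless some cluster of `a` carries a cross double linkage together with a same-side `b`-clash.**
`H` carries the positive pairs.  Suppose that for every `K ∋ a` with `b, c ∉ K`, `H`-connected from `a`, all `y ≠ y'` outside
`K ∪ {a, b, c}` and `z` outside `K ∪ {c, y, y'}` (`z = b` allowed), each joined to `K`: EITHER every triple of walks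
`y → b`, `y' → c`, `z → b` in `H − K` has `y → b` or `z → b` meeting `y' → c`, OR every triple `y → c`, `y' → b`, `z → b` in
`H − K` has `y' → b` or `z → b` meeting `y → c`.  Then the no-quadruple-clash hypothesis of
`Consts.clusterSquare_le_sq_of_noQuadClash_pos` holds (the fourth clash vertex is not needed).
[folklore; input for Gladkov2024, Thm. 4.3] -/
theorem not_quadClash_of_unlinked₃ (H : SimpleGraph V) (w : Sym2 V → unitInterval) {a b c : V}
    (hH : ∀ u v, u ≠ v → (0 : ℝ) < w s(u, v) → H.Adj u v)
    (hK : ∀ (K : Set V) (y y' z : V), a ∈ K → b ∉ K → c ∉ K →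
      (∀ T : Set V, a ∈ T → (∀ u x, u ∈ T → H.Adj u x → x ∈ K → x ∈ T) → K ⊆ T) →
      y ∉ K → y' ∉ K → z ∉ K → (∃ k, k ∈ K ∧ H.Adj k y) → (∃ k, k ∈ K ∧ H.Adj k y') → (∃ k, k ∈ K ∧ H.Adj k z) →
      y ≠ a → y ≠ b → y ≠ c → y' ≠ a → y' ≠ b → y' ≠ c → y ≠ y' → z ≠ c → z ≠ y → z ≠ y' →
      (∀ (P₁ : H.Walk y b) (P₂ : H.Walk y' c) (W : H.Walk z b), (∀ x ∈ P₁.support, x ∉ K) →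
          (∀ x ∈ P₂.support, x ∉ K) → (∀ x ∈ W.support, x ∉ K) →
          (∃ x, x ∈ P₁.support ∧ x ∈ P₂.support) ∨ (∃ x, x ∈ W.support ∧ x ∈ P₂.support)) ∨
      (∀ (Q₁ : H.Walk y c) (Q₂ : H.Walk y' b) (W : H.Walk z b), (∀ x ∈ Q₁.support, x ∉ K) →
          (∀ x ∈ Q₂.support, x ∉ K) → (∀ x ∈ W.support, x ∉ K) →
          (∃ x, x ∈ Q₁.support ∧ x ∈ Q₂.support) ∨ (∃ x, x ∈ W.support ∧ x ∈ Q₁.support)))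
    {ω η : Set (Sym2 V)} (hω : ∀ e ∈ ω, (0 : ℝ) < w e) (hη : ∀ e ∈ η, (0 : ℝ) < w e)
    (hab : ¬ (openGraph ω).Reachable a b) (hac : ¬ (openGraph ω).Reachable a c) (hbc : ¬ (openGraph ω).Reachable b c)
    (hbc' : ¬ (openGraph (η \ barOf {a} (setCl ω {a}))).Reachable b c) :
    ¬ ((∃ y k : V, (openGraph ω).Reachable a k ∧ (0 : ℝ) < w s(k, y) ∧ (openGraph ω).Reachable b y ∧
          (openGraph (η \ barOf {a} (setCl ω {a}))).Reachable c y) ∧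
       (∃ y k : V, (openGraph ω).Reachable a k ∧ (0 : ℝ) < w s(k, y) ∧ (openGraph ω).Reachable c y ∧
          (openGraph (η \ barOf {a} (setCl ω {a}))).Reachable b y) ∧
       (∃ y k : V, (openGraph ω).Reachable a k ∧ (0 : ℝ) < w s(k, y) ∧ (openGraph ω).Reachable b y ∧
          (openGraph (η \ barOf {a} (setCl ω {a}))).Reachable b y) ∧
       (∃ y k : V, (openGraph ω).Reachable a k ∧ (0 : ℝ) < w s(k, y) ∧ (openGraph ω).Reachable c y ∧
          (openGraph (η \ barOf {a} (setCl ω {a}))).Reachable c y)) := by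
  rintro ⟨⟨y, k, hk, hw, hby, hcy⟩, ⟨y', k', hk', hw', hcy', hby'⟩, ⟨z, k₃, hk₃, hw₃, hbz, hbz'⟩, -⟩
  set θ := η \ barOf {a} (setCl ω {a}) with hθdef
  set K : Set V := {x | (openGraph ω).Reachable a x} with hKdef
  have hadjH : ∀ (ξ : Set (Sym2 V)), (∀ e ∈ ξ, (0 : ℝ) < w e) → openGraph ξ ≤ H := by
    intro ξ hξ u v huv
    rw [openGraph_adj] at huv
    exact hH u v huv.2 (hξ _ huv.1)
  have hθ : ∀ e ∈ θ, (0 : ℝ) < w e := fun e he => hη e he.1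
  have hθK : ∀ u v, (openGraph θ).Adj u v → ¬ (openGraph ω).Reachable a v := by
    intro u v huv hav
    rw [openGraph_adj, hθdef, barOf_setCl_singleton_eq_cutSet] at huv
    exact huv.1.2 ⟨v, Sym2.mem_mk_right u v, hav⟩
  have hky : H.Adj k y := hH k y (fun h => hab (hk.trans (h ▸ hby.symm))) hw
  have hky' : H.Adj k' y' := hH k' y' (fun h => hac (hk'.trans (h ▸ hcy'.symm))) hw'
  have hk₃z : H.Adj k₃ z := hH k₃ z (fun h => hab (hk₃.trans (h ▸ hbz.symm))) hw₃
  have hyK : y ∉ K := fun h => hab (h.trans hby.symm)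
  have hyK' : y' ∉ K := fun h => hac (h.trans hcy'.symm)
  have hzK : z ∉ K := fun h => hab (h.trans hbz.symm)
  have hconn : ∀ T : Set V, a ∈ T → (∀ u x, u ∈ T → H.Adj u x → x ∈ K → x ∈ T) → K ⊆ T := by
    intro T haT hT x hx
    obtain ⟨X⟩ := id hx
    exact mem_of_openWalk_adm H T (fun z => z ∈ K) (fun u z hu huz hz => hT u z hu huz hz) (hadjH ω hω) X haT
      fun z hz => Or.inr (show (openGraph ω).Reachable a z from ⟨X.takeUntil z hz⟩)
  -- the six walks
  obtain ⟨P₁⟩ := hby.symm   -- ω: y → b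
  obtain ⟨P₂⟩ := hcy'.symm  -- ω: y' → c
  obtain ⟨W₁⟩ := hbz.symm   -- ω: z → b
  obtain ⟨Q₁⟩ := hcy.symm   -- θ: y → c
  obtain ⟨Q₂⟩ := hby'.symm  -- θ: y' → b
  obtain ⟨W₂⟩ := hbz'.symm  -- θ: z → b
  have hP₁ : ∀ x ∈ P₁.support, (openGraph ω).Reachable b x := fun x hx => hby.trans ⟨P₁.takeUntil x hx⟩
  have hP₂ : ∀ x ∈ P₂.support, (openGraph ω).Reachable c x := fun x hx => hcy'.trans ⟨P₂.takeUntil x hx⟩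
  have hW₁ : ∀ x ∈ W₁.support, (openGraph ω).Reachable b x := fun x hx => hbz.trans ⟨W₁.takeUntil x hx⟩
  have hQ₁ : ∀ x ∈ Q₁.support, (openGraph θ).Reachable c x := fun x hx => hcy.trans ⟨Q₁.takeUntil x hx⟩
  have hQ₂ : ∀ x ∈ Q₂.support, (openGraph θ).Reachable b x := fun x hx => hby'.trans ⟨Q₂.takeUntil x hx⟩
  have hW₂ : ∀ x ∈ W₂.support, (openGraph θ).Reachable b x := fun x hx => hbz'.trans ⟨W₂.takeUntil x hx⟩
  have hQ₁K : ∀ x ∈ Q₁.support, x ∉ K := not_reachable_of_mem_support a hθK Q₁ hyK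
  have hQ₂K : ∀ x ∈ Q₂.support, x ∉ K := not_reachable_of_mem_support a hθK Q₂ hyK'
  have hW₂K : ∀ x ∈ W₂.support, x ∉ K := not_reachable_of_mem_support a hθK W₂ hzK
  rcases hK K y y' z (SimpleGraph.Reachable.refl a) hab hac hconn hyK hyK' hzK ⟨k, hk, hky⟩ ⟨k', hk', hky'⟩ ⟨k₃, hk₃, hk₃z⟩
      (fun h => hyK (by rw [h]; exact SimpleGraph.Reachable.refl a)) (fun h => hbc' (by rw [← h]; exact hcy.symm))
      (fun h => hbc (by rw [← h]; exact hby)) (fun h => hyK' (by rw [h]; exact SimpleGraph.Reachable.refl a))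
      (fun h => hbc (by rw [← h]; exact hcy'.symm)) (fun h => hbc' (by rw [← h]; exact hby'))
      (fun h => hbc (hby.trans (by rw [h]; exact hcy'.symm))) (fun h => hbc (by rw [← h]; exact hbz))
      (fun h => hbc' (hbz'.trans (by rw [h]; exact hcy.symm))) (fun h => hbc (hbz.trans (by rw [h]; exact hcy'.symm)))
      with hlink | hlink
  · have e₁ := SimpleGraph.Walk.support_mapLe_eq_support (hadjH ω hω) P₁
    have e₂ := SimpleGraph.Walk.support_mapLe_eq_support (hadjH ω hω) P₂
    have e₃ := SimpleGraph.Walk.support_mapLe_eq_support (hadjH ω hω) W₁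
    rcases hlink (P₁.mapLe (hadjH ω hω)) (P₂.mapLe (hadjH ω hω)) (W₁.mapLe (hadjH ω hω))
      (fun x hx => fun hxK => hab (hxK.trans (hP₁ x (by rwa [e₁] at hx)).symm))
      (fun x hx => fun hxK => hac (hxK.trans (hP₂ x (by rwa [e₂] at hx)).symm))
      (fun x hx => fun hxK => hab (hxK.trans (hW₁ x (by rwa [e₃] at hx)).symm)) with ⟨x, hx₁, hx₂⟩ | ⟨x, hx₁, hx₂⟩
    · rw [e₁] at hx₁; rw [e₂] at hx₂
      exact hbc ((hP₁ x hx₁).trans (hP₂ x hx₂).symm)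
    · rw [e₃] at hx₁; rw [e₂] at hx₂
      exact hbc ((hW₁ x hx₁).trans (hP₂ x hx₂).symm)
  · have e₁ := SimpleGraph.Walk.support_mapLe_eq_support (hadjH _ hθ) Q₁
    have e₂ := SimpleGraph.Walk.support_mapLe_eq_support (hadjH _ hθ) Q₂
    have e₃ := SimpleGraph.Walk.support_mapLe_eq_support (hadjH _ hθ) W₂
    rcases hlink (Q₁.mapLe (hadjH _ hθ)) (Q₂.mapLe (hadjH _ hθ)) (W₂.mapLe (hadjH _ hθ))
      (fun x hx => hQ₁K x (by rwa [e₁] at hx)) (fun x hx => hQ₂K x (by rwa [e₂] at hx))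
      (fun x hx => hW₂K x (by rwa [e₃] at hx)) with ⟨x, hx₁, hx₂⟩ | ⟨x, hx₁, hx₂⟩
    · rw [e₁] at hx₁; rw [e₂] at hx₂
      exact hbc' ((hQ₂ x hx₂).trans (hQ₁ x hx₁).symm)
    · rw [e₃] at hx₁; rw [e₁] at hx₂
      exact hbc' ((hW₂ x hx₁).trans (hQ₁ x hx₂).symm)

end General

namespace Apex

variable {n m : ℕ} {pos : Fin n → Fin m} {h : Fin n}

/-- Order fact 1: if neither `Y` nor `Y'` lies strictly between the other and `B`, then `B` lies strictly between them. [folklore] -/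
private theorem arith_q₁ {Y Y' B : ℕ} (dYY' : Y ≠ Y') (dYB : Y ≠ B) (dY'B : Y' ≠ B)
    (f1 : ¬ (Y' < Y ∧ Y < B) ∧ ¬ (B < Y ∧ Y < Y')) (f2 : ¬ (Y < Y' ∧ Y' < B) ∧ ¬ (B < Y' ∧ Y' < Y)) :
    (Y < B ∧ B < Y') ∨ (Y' < B ∧ B < Y) := by
  omega

/-- Order fact 2: with `P < B < Q`, `B` not strictly between `Z` and `Q` nor between `X` and `P` gives `X < B < Z`. [folklore] -/
private theorem arith_q₂ {P Q B X Z : ℕ} (lP : P < B) (lQ : B < Q) (dXB : X ≠ B) (dZB : Z ≠ B)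
    (fZ : ¬ (Z < B ∧ B < Q) ∧ ¬ (Q < B ∧ B < Z)) (fX : ¬ (X < B ∧ B < P) ∧ ¬ (P < B ∧ B < X)) :
    X < B ∧ B < Z := by
  omega

/-- Order fact 3: with `X₁ < B < X₂`, a point `Z ≠ X₁, X₂` such that `X₂ ∉ (Z, B)`, `X₂ ∉ (B, Z)`, `X₁ ∉ (Z, B)`, `X₁ ∉ (B, Z)`
lies strictly between `X₁` and `X₂`. [folklore] -/
private theorem arith_q₃ {B X₁ X₂ Z : ℕ} (e1 : X₁ < B) (e2 : B < X₂) (d1Z : X₁ ≠ Z) (d2Z : X₂ ≠ Z)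
    (g3 : ¬ (Z < X₂ ∧ X₂ < B) ∧ ¬ (B < X₂ ∧ X₂ < Z)) (g4 : ¬ (Z < X₁ ∧ X₁ < B) ∧ ¬ (B < X₁ ∧ X₁ < Z)) :
    X₁ < Z ∧ Z < X₂ := by
  omega

/-- Order fact 4: with `Z` strictly between `X₁` and `X₂` and `K'` not between them, `{K', Z}` interleaves `{X₁, X₂}`. [folklore] -/
private theorem arith_q₄ {Z X₁ X₂ K' : ℕ} (dK1 : K' ≠ X₁) (dK2 : K' ≠ X₂)
    (hz : (X₁ < Z ∧ Z < X₂) ∨ (X₂ < Z ∧ Z < X₁)) (kg : ¬ (X₁ < K' ∧ K' < X₂) ∧ ¬ (X₂ < K' ∧ K' < X₁)) :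
    (K' < X₁ ∧ X₁ < Z ∧ Z < X₂) ∨ (X₁ < Z ∧ Z < X₂ ∧ X₂ < K') ∨ (K' < X₂ ∧ X₂ < Z ∧ Z < X₁) ∨
      (X₂ < Z ∧ Z < X₁ ∧ X₁ < K') := by
  omega

section Endgame

variable {H G₀ H' : SimpleGraph (Fin n)} {a : Fin n}
  (hpos : ∀ u v, u ≠ h → v ≠ h → pos u = pos v → u = v)
  (g1 : ∀ u v, H.Adj u v → u ≠ h → v ≠ h → G₀.Adj u v)
  (g2 : ∀ u v, H.Adj u v → u ≠ h → v ≠ h → H'.Adj u v)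
  (g3 : ∀ u v, u ≠ v → u ≠ h → v ≠ h → H.Adj h u → H.Adj h v → H'.Adj u v)
  (x1 : ∀ p q r s : Fin n, H'.Adj p q → G₀.Adj r s → (pos p - pos a).val < (pos r - pos a).val →
    (pos r - pos a).val < (pos q - pos a).val → (pos q - pos a).val < (pos s - pos a).val → False)
  (x2 : ∀ p q r s : Fin n, G₀.Adj p q → H'.Adj r s → (pos p - pos a).val < (pos r - pos a).val →
    (pos r - pos a).val < (pos q - pos a).val → (pos q - pos a).val < (pos s - pos a).val → False)
  (ha : a ≠ h)
include hpos g1 g2 g3 x1 x2 ha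

/-- APEX-TERMINAL TRIPLE-CLASH ENDGAME (no sector condition): an `H`-connected `K ∋ a` avoiding the apex cannot carry, for RIM
vertices `y ≠ y'` and `z ∉ {y, y', h}` each joined to `K`, a cross double linkage `(y → b, y' → h)`, `(y → h, y' → b)` by walks
avoiding `K` (disjoint within each pair) TOGETHER WITH walks `z → b` avoiding `K`, the first disjoint from `y' → h`, the second
disjoint from `y → h`.  Cut open at `a`: the double linkage puts `b` strictly between the apex-neighbours `x₁, x₂` ending `y → h`,
`y' → h`; the `z`-walks put `z` strictly between `x₁` and `x₂` as well, while the `K`-neighbour of `z` lies outside the common gap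
— the rim edge to it separates `x₁` from `x₂`, a forbidden crossing. [folklore: Jordan curve] -/
theorem false_of_clash₃ {K : Set (Fin n)} (hKw : ∀ s ∈ K, ∃ W : H.Walk a s, ∀ v ∈ W.support, v ∈ K)
    {b y y' z k k' k₃ : Fin n} (hb : b ≠ h) (hyh : y ≠ h) (hy'h : y' ≠ h) (hzh : z ≠ h)
    (hkK : k ∈ K) (hky : H.Adj k y) (hk'K : k' ∈ K) (hk'y' : H.Adj k' y') (hk₃K : k₃ ∈ K) (hk₃z : H.Adj k₃ z)
    (hyb : y ≠ b) (hy'b : y' ≠ b) (hyy' : y ≠ y')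
    (P₁ : H.Walk y b) (P₂ : H.Walk y' h) (hP₁ : ∀ x ∈ P₁.support, x ∉ K) (hP₂ : ∀ x ∈ P₂.support, x ∉ K)
    (hPd : ∀ x, x ∈ P₁.support → x ∉ P₂.support)
    (W₁ : H.Walk z b) (hW₁ : ∀ x ∈ W₁.support, x ∉ K) (hW₁d : ∀ x, x ∈ W₁.support → x ∉ P₂.support)
    (Q₁ : H.Walk y h) (Q₂ : H.Walk y' b) (hQ₁ : ∀ x ∈ Q₁.support, x ∉ K) (hQ₂ : ∀ x ∈ Q₂.support, x ∉ K)
    (hQd : ∀ x, x ∈ Q₁.support → x ∉ Q₂.support)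
    (W₂ : H.Walk z b) (hW₂ : ∀ x ∈ W₂.support, x ∉ K) (hW₂d : ∀ x, x ∈ W₂.support → x ∉ Q₁.support) : False := by
  have haK : a ∈ K := by
    obtain ⟨W, hW⟩ := hKw k hkK
    exact hW a W.start_mem_support
  have hhK : h ∉ K := fun hh => hP₂ h P₂.end_mem_support hh
  have hyP₁ : y ∈ P₁.support := P₁.start_mem_support
  have hbP₁ : b ∈ P₁.support := P₁.end_mem_support
  have hy'P₂ : y' ∈ P₂.support := P₂.start_mem_support
  have hyQ₁ : y ∈ Q₁.support := Q₁.start_mem_support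
  have hy'Q₂ : y' ∈ Q₂.support := Q₂.start_mem_support
  have hbQ₂ : b ∈ Q₂.support := Q₂.end_mem_support
  have hzW₁ : z ∈ W₁.support := W₁.start_mem_support
  have hbW₁ : b ∈ W₁.support := W₁.end_mem_support
  have hzW₂ : z ∈ W₂.support := W₂.start_mem_support
  have hbW₂ : b ∈ W₂.support := W₂.end_mem_support
  have D : ∀ {u v : Fin n}, u ≠ h → v ≠ h → u ≠ v → (pos u - pos a).val ≠ (pos v - pos a).val :=
    fun hu hv huv e => huv (hpos _ _ hu hv (NonCrossing.rot_injective (pos a) e))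
  -- the walks to the apex, reversed, start with apex-neighbours `x₂` (of `P₂`) and `x₁` (of `Q₁`)
  suffices main : ∀ (R₂ : H.Walk h y') (R₁ : H.Walk h y), (∀ x ∈ R₂.support, x ∈ P₂.support) →
      (∀ x ∈ R₁.support, x ∈ Q₁.support) → False by
    exact main P₂.reverse Q₁.reverse
      (fun x hx => by rwa [SimpleGraph.Walk.support_reverse, List.mem_reverse] at hx)
      (fun x hx => by rwa [SimpleGraph.Walk.support_reverse, List.mem_reverse] at hx)
  intro R₂ R₁ hR₂ hR₁
  cases R₂ with
  | nil => exact hy'h rfl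
  | @cons _ x₂ _ hx₂ T₂ =>
  cases R₁ with
  | nil => exact hyh rfl
  | @cons _ x₁ _ hx₁ T₁ =>
  have hx₂R : x₂ ∈ (SimpleGraph.Walk.cons hx₂ T₂).support := by simp
  have hy'R : y' ∈ (SimpleGraph.Walk.cons hx₂ T₂).support := SimpleGraph.Walk.end_mem_support _
  have hx₁R : x₁ ∈ (SimpleGraph.Walk.cons hx₁ T₁).support := by simp
  have hyR : y ∈ (SimpleGraph.Walk.cons hx₁ T₁).support := SimpleGraph.Walk.end_mem_support _
  have hx₂P₂ : x₂ ∈ P₂.support := hR₂ x₂ hx₂R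
  have hx₁Q₁ : x₁ ∈ Q₁.support := hR₁ x₁ hx₁R
  have hx₁h : x₁ ≠ h := fun e => hx₁.ne e.symm
  have hx₂h : x₂ ≠ h := fun e => hx₂.ne e.symm
  have hk₃h : k₃ ≠ h := fun e => hhK (e ▸ hk₃K)
  have hx₁K : x₁ ∉ K := hQ₁ x₁ hx₁Q₁
  have hx₂K : x₂ ∉ K := hP₂ x₂ hx₂P₂
  have hx₁b : x₁ ≠ b := fun e => hQd x₁ hx₁Q₁ (by rw [e]; exact hbQ₂)
  have hx₂b : x₂ ≠ b := fun e => hPd b hbP₁ (by rw [← e]; exact hx₂P₂)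
  have hx₁z : x₁ ≠ z := fun e => hW₂d z hzW₂ (by rw [← e]; exact hx₁Q₁)
  have hx₂z : x₂ ≠ z := fun e => hW₁d z hzW₁ (by rw [← e]; exact hx₂P₂)
  have hk₃x₁ : k₃ ≠ x₁ := fun e => hx₁K (e ▸ hk₃K)
  have hk₃x₂ : k₃ ≠ x₂ := fun e => hx₂K (e ▸ hk₃K)
  have dYY' := D hyh hy'h hyy'
  have dYB := D hyh hb hyb
  have dY'B := D hy'h hb hy'b
  have d1B := D hx₁h hb hx₁b
  have d2B := D hx₂h hb hx₂b
  have d1Z := D hx₁h hzh hx₁z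
  have d2Z := D hx₂h hzh hx₂z
  have dK1 := D hk₃h hx₁h hk₃x₁
  have dK2 := D hk₃h hx₂h hk₃x₂
  -- (1) `b` strictly between `y` and `y'`
  have hSy := NonCrossing.walks_extend hKw hkK hky (SimpleGraph.Walk.nil : H.Walk y y)
  have hSy' := NonCrossing.walks_extend hKw hk'K hk'y' (SimpleGraph.Walk.nil : H.Walk y' y')
  have memy : ∀ v, v ∈ K ∪ {v | v ∈ (SimpleGraph.Walk.nil : H.Walk y y).support} ↔ v ∈ K ∨ v = y := fun v => by
    simp only [Set.mem_union, Set.mem_setOf_eq, SimpleGraph.Walk.support_nil, List.mem_singleton]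
  have memy' : ∀ v, v ∈ K ∪ {v | v ∈ (SimpleGraph.Walk.nil : H.Walk y' y').support} ↔ v ∈ K ∨ v = y' := fun v => by
    simp only [Set.mem_union, Set.mem_setOf_eq, SimpleGraph.Walk.support_nil, List.mem_singleton]
  have F1 := cnt_eq_ends hpos g1 g2 g3 x1 x2 ha hSy
    (S' := {s | s ∈ K ∪ {v | v ∈ (SimpleGraph.Walk.nil : H.Walk y y).support} ∧ s ≠ h}) (fun _ => Iff.rfl) Q₂
    (fun v hv hvS => by
      rcases (memy v).1 hvS with hvK | rfl
      · exact hQ₂ v hv hvK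
      · exact hQd _ hyQ₁ hv) hy'h hb
  have F2 := cnt_eq_ends hpos g1 g2 g3 x1 x2 ha hSy'
    (S' := {s | s ∈ K ∪ {v | v ∈ (SimpleGraph.Walk.nil : H.Walk y' y').support} ∧ s ≠ h}) (fun _ => Iff.rfl) P₁
    (fun v hv hvS => by
      rcases (memy' v).1 hvS with hvK | rfl
      · exact hP₁ v hv hvK
      · exact hPd _ hv hy'P₂) hyh hb
  have f1 := NonCrossing.not_between_of_cnt_eq_pos' a _ F1 (⟨(memy y).2 (Or.inr rfl), hyh⟩ :
    y ∈ ({s | s ∈ K ∪ {v | v ∈ (SimpleGraph.Walk.nil : H.Walk y y).support} ∧ s ≠ h} : Set (Fin n)))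
  have f2 := NonCrossing.not_between_of_cnt_eq_pos' a _ F2 (⟨(memy' y').2 (Or.inr rfl), hy'h⟩ :
    y' ∈ ({s | s ∈ K ∪ {v | v ∈ (SimpleGraph.Walk.nil : H.Walk y' y').support} ∧ s ≠ h} : Set (Fin n)))
  have hB := arith_q₁ dYY' dYB dY'B f1 f2
  -- (2) `b ∉ (x₂, y')` from `K ∪ supp P₁` vs `h → y'`;  `b ∉ (x₁, y)` from `K ∪ supp Q₂` vs `h → y`
  have hS₃ := NonCrossing.walks_extend hKw hkK hky P₁
  have F3 := cnt_eq_of_walk hpos g1 g2 g3 x1 x2 ha hS₃ (S' := {s | s ∈ K ∪ {v | v ∈ P₁.support} ∧ s ≠ h})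
    (fun _ => Iff.rfl) (SimpleGraph.Walk.cons hx₂ T₂) (fun v hv hvS => by
      rcases hvS with hvK | hvP
      · exact hP₂ v (hR₂ v hv) hvK
      · exact hPd v hvP (hR₂ v hv)) x₂ hx₂R y' hy'R hx₂h hy'h
  have f3 := NonCrossing.not_between_of_cnt_eq_pos' a _ F3 ⟨Or.inr hbP₁, hb⟩
  have hS₄ := NonCrossing.walks_extend hKw hk'K hk'y' Q₂
  have F4 := cnt_eq_of_walk hpos g1 g2 g3 x1 x2 ha hS₄ (S' := {s | s ∈ K ∪ {v | v ∈ Q₂.support} ∧ s ≠ h})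
    (fun _ => Iff.rfl) (SimpleGraph.Walk.cons hx₁ T₁) (fun v hv hvS => by
      rcases hvS with hvK | hvQ
      · exact hQ₁ v (hR₁ v hv) hvK
      · exact hQd v (hR₁ v hv) hvQ) x₁ hx₁R y hyR hx₁h hyh
  have f4 := NonCrossing.not_between_of_cnt_eq_pos' a _ F4 ⟨Or.inr hbQ₂, hb⟩
  -- (3) `x₂` not between `z` and `b` (from `K ∪ supp P₂` vs `W₁`), `x₁` not between `z` and `b` (from `K ∪ supp Q₁` vs `W₂`)
  have hS₅ := NonCrossing.walks_extend hKw hk'K hk'y' P₂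
  have G3 := cnt_eq_ends hpos g1 g2 g3 x1 x2 ha hS₅ (S' := {s | s ∈ K ∪ {v | v ∈ P₂.support} ∧ s ≠ h})
    (fun _ => Iff.rfl) W₁ (fun v hv hvS => by
      rcases hvS with hvK | hvP
      · exact hW₁ v hv hvK
      · exact hW₁d v hv hvP) hzh hb
  have g₃ := NonCrossing.not_between_of_cnt_eq_pos' a _ G3 ⟨Or.inr hx₂P₂, hx₂h⟩
  have hS₆ := NonCrossing.walks_extend hKw hkK hky Q₁
  have G4 := cnt_eq_ends hpos g1 g2 g3 x1 x2 ha hS₆ (S' := {s | s ∈ K ∪ {v | v ∈ Q₁.support} ∧ s ≠ h})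
    (fun _ => Iff.rfl) W₂ (fun v hv hvS => by
      rcases hvS with hvK | hvQ
      · exact hW₂ v hv hvK
      · exact hW₂d v hv hvQ) hzh hb
  have g₄ := NonCrossing.not_between_of_cnt_eq_pos' a _ G4 ⟨Or.inr hx₁Q₁, hx₁h⟩
  -- (4) the gap of `K`: `x₁, y, b, y', x₂` have the same count, so `k₃ ∈ K` is not between `x₁` and `x₂`
  have c1 := cnt_eq_of_walk hpos g1 g2 g3 x1 x2 ha hKw (S' := {v | v ∈ K ∧ v ≠ h}) (fun _ => Iff.rfl)
    (SimpleGraph.Walk.cons hx₁ T₁) (fun v hv => hQ₁ v (hR₁ v hv)) x₁ hx₁R y hyR hx₁h hyh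
  have c2 := cnt_eq_ends hpos g1 g2 g3 x1 x2 ha hKw (S' := {v | v ∈ K ∧ v ≠ h}) (fun _ => Iff.rfl) P₁ hP₁ hyh hb
  have c3 := cnt_eq_ends hpos g1 g2 g3 x1 x2 ha hKw (S' := {v | v ∈ K ∧ v ≠ h}) (fun _ => Iff.rfl) Q₂ hQ₂ hy'h hb
  have c4 := cnt_eq_of_walk hpos g1 g2 g3 x1 x2 ha hKw (S' := {v | v ∈ K ∧ v ≠ h}) (fun _ => Iff.rfl)
    (SimpleGraph.Walk.cons hx₂ T₂) (fun v hv => hP₂ v (hR₂ v hv)) x₂ hx₂R y' hy'R hx₂h hy'h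
  have kg := NonCrossing.not_between_of_cnt_eq_pos' a _ (c1.trans (c2.trans (c3.symm.trans c4.symm))) ⟨hk₃K, hk₃h⟩
  -- (5) `z` strictly between `x₁` and `x₂`, and the rim edge `{k₃, z}` interleaves the chord `{x₁, x₂}`
  have hz : ((pos x₁ - pos a).val < (pos z - pos a).val ∧ (pos z - pos a).val < (pos x₂ - pos a).val) ∨
      ((pos x₂ - pos a).val < (pos z - pos a).val ∧ (pos z - pos a).val < (pos x₁ - pos a).val) := by
    rcases hB with ⟨l1, l2⟩ | ⟨l1, l2⟩
    · obtain ⟨e1, e2⟩ := arith_q₂ l1 l2 d1B d2B f3 f4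
      exact Or.inl (arith_q₃ e1 e2 d1Z d2Z g₃ g₄)
    · obtain ⟨e1, e2⟩ := arith_q₂ l1 l2 d2B d1B f4 f3
      exact Or.inr (arith_q₃ e1 e2 d2Z d1Z g₄ g₃)
  have hG : G₀.Adj k₃ z := g1 k₃ z hk₃z hk₃h hzh
  rcases arith_q₄ dK1 dK2 hz kg with ⟨l1, l2, l3⟩ | ⟨l1, l2, l3⟩ | ⟨l1, l2, l3⟩ | ⟨l1, l2, l3⟩
  · have hne : x₁ ≠ x₂ := fun e => by rw [e] at l2; omega
    exact x2 k₃ z x₁ x₂ hG (g3 x₁ x₂ hne hx₁h hx₂h hx₁ hx₂) l1 l2 l3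
  · have hne : x₁ ≠ x₂ := fun e => by rw [e] at l1; omega
    exact x1 x₁ x₂ z k₃ (g3 x₁ x₂ hne hx₁h hx₂h hx₁ hx₂) hG.symm l1 l2 l3
  · have hne : x₂ ≠ x₁ := fun e => by rw [e] at l2; omega
    exact x2 k₃ z x₂ x₁ hG (g3 x₂ x₁ hne hx₂h hx₁h hx₂ hx₁) l1 l2 l3
  · have hne : x₂ ≠ x₁ := fun e => by rw [e] at l1; omega
    exact x1 x₂ x₁ z k₃ (g3 x₂ x₁ hne hx₂h hx₁h hx₂ hx₁) hG.symm l1 l2 l3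

end Endgame

end Apex

end Consts

end Summit.CriticalPhenomena.PercolationContinuityZ3.Theorems
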